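import Summits.ResolutionOfSingularities.ResolutionOfSingularities.Theorems.EquisingularLiftEquisingularLiftNatCompleteIntersectionLiftKey
import Literature.AlgebraicGeometry.Motives.ProjBaseChangeAny
import HarnessLib

/-!
# EL♮(3) / EL♮(n), RUNG LC «large characteristic» — brick (B5′)(c3): THE TYING — the fibre of the pulled-back hypersurface ideal `Ĩ` of `ℙⁿ_A` in a
# graded-lift square over `θ : B → k` is the zero locus of the specialised equations

leafhand-res-equisingularlift-3 g0 (prover, 2026-08-31; one-generation line-first hand on stmt-ResolutionOfSingularities-20148 / -20038 /
-15660, cell `pub/decomp-res`).  Crux `EquisingularLiftNatThree` (`stmt-…-20148`; uniform in `n`, so also `stmt-…-20038`), line W4.5(b), RUNG LC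
(idea-2 g32 `Cruxes/EquisingularLiftNatThree/LARGE-CHAR-RUNG-idea2.md` v1.6 §(B5′)(c3) «TYING `Cut` ⇒ `Set.range ι.base = (Proj.map φ hφ').base ⁻¹' 𝓗_B`
… preimage of a zero locus under `Proj.map φ` = zero locus of the image»).  The door ✓ `exists_forall_descDoorAt_of_K_word_smooth` (…NatLargeCharSpreadDoorSmoothBase)
asks, for every graded lift `φ` of `θ`, that `Set.range ι` be the support of `((𝓣.comap G_B).comap (Proj.map φ))` for the running ideal `𝓣` on `ℙⁿ_A`
and `G_B : ℙⁿ_B → ℙⁿ_A` the base change.  For `𝓣 = Ĩ` the ideal sheaf of a homogeneous ideal `I` of `A[x₀,…,xₙ]` (✓ `projIdealSheaf`, Hartshorne II 5.9)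
this support IS the zero locus of the specialised generators — so the rung's `Cut k H ι F` may be the honest «`range ι = V₊(F)`».  DEF-FREE:

* ★ `support_comap_comap_projIdealSheaf` — for any homogeneous ideal `I ⊆ A[x]`, any `A`-algebra `B`, any graded `φ : B[x] → k[x]`:
  `supp ((Ĩ.comap G_B).comap (Proj.map φ)) = {x : ℙⁿ_k | ∀ g ∈ I, φ (g ⊗ 1) ∈ x}` (Mathlib `support_comap` ×2, ✓ `CILift.support_projIdealSheaf_eq`; the point
  map of `Proj.map` is `comap` by `rfl`);
* `support_comap_comap_projIdealSheaf_span_singleton` — the hypersurface case `I = (F)`, with `φ (F ⊗ 1) = MvPolynomial.map θ' F` for any ring map `θ'`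
  through which `φ ∘ (A[x] → B[x])` acts on `F` (e.g. `θ' = θ ∘ (A → B)` when `φ = map θ`, ✓ `ProjBaseChangeRing.mapGraded_apply`, `MvPolynomial.map_map`):
  `supp (…) = {x | MvPolynomial.map θ' F ∈ x.asHomogeneousIdeal}`.

HONEST RESIDUAL of `hspread` (unchanged otherwise): K-side inputs for the universal hypersurface (reduced generic equation + geometric-integrality dichotomy +
✓ `LargeChar.exists_centreSeq_descTransformOK`; note `supp √Ĩ = supp Ĩ`), point bookkeeping, N:=1 glue (lh2), final composition.  EL♮(3) NOT proved; EL♮ NOT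
proved; resolution of singularities in positive characteristic NOT proved; nothing of [Hironaka2017] (a candidate under adjudication) is asserted or used.
[OURS · bookkeeping · standard axioms · DEF-FREE · `--supports stmt-ResolutionOfSingularities-20148 --as helper`, counted 0 · AI-written, weaker than expert
review.] [cite: Hartshorne1977, II Prop. 5.9] (method; index only)
-/

set_option linter.dupNamespace false -- mandated namespace `Summit.<Summit>.<Problem>` of this single-conjunct summit

noncomputable section

open CategoryTheory CategoryTheory.Limits AlgebraicGeometry TopologicalSpace
open MvPolynomial
open Literature.AlgebraicGeometry.Resolution
open Literature.AlgebraicGeometry.Motives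
open AlgebraicGeometry.Scheme.IdealSheafData

namespace Summit.ResolutionOfSingularities.ResolutionOfSingularities.Cruxes.EquisingularLiftNat.Sections

section Tie

variable (A B k : Type) [CommRing A] [CommRing B] [CommRing k] [Algebra A B] (n : ℕ)

/-- ★ **The tying**: for a homogeneous ideal `I` of `A[x₀,…,xₙ]`, an `A`-algebra `B` (base change `G_B : ℙⁿ_B → ℙⁿ_A`) and a graded ring map
`φ : B[x] → k[x]` (with the irrelevant-ideal condition of `Proj.map`), the support of `((Ĩ.comap G_B).comap (Proj.map φ))` on `ℙⁿ_k` is the zero locus of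
the specialised members of `I`: `{x | ∀ g ∈ I, φ (G_B^♯ g) ∈ x}`. [cite: Hartshorne1977, II Prop. 5.9] [OURS · L1 W4.5b · RUNG LC (B5′)(c3)] -/
theorem support_comap_comap_projIdealSheaf
    (I : letI := MvPolynomial.gradedAlgebra (σ := Fin (n + 1)) (R := A); HomogeneousIdeal (homogeneousSubmodule (Fin (n + 1)) A))
    (φ : letI := MvPolynomial.gradedAlgebra (σ := Fin (n + 1)) (R := B)
      letI := MvPolynomial.gradedAlgebra (σ := Fin (n + 1)) (R := k)
      homogeneousSubmodule (Fin (n + 1)) B →+*ᵍ homogeneousSubmodule (Fin (n + 1)) k)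
    (hφ' : letI := MvPolynomial.gradedAlgebra (σ := Fin (n + 1)) (R := B)
      letI := MvPolynomial.gradedAlgebra (σ := Fin (n + 1)) (R := k)
      HomogeneousIdeal.irrelevant (homogeneousSubmodule (Fin (n + 1)) k) ≤
        (HomogeneousIdeal.irrelevant (homogeneousSubmodule (Fin (n + 1)) B)).map φ) :
    letI := MvPolynomial.gradedAlgebra (σ := Fin (n + 1)) (R := A)
    letI := MvPolynomial.gradedAlgebra (σ := Fin (n + 1)) (R := B)
    letI := MvPolynomial.gradedAlgebra (σ := Fin (n + 1)) (R := k)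
    (((((projIdealSheaf (homogeneousSubmodule (Fin (n + 1)) A) I).comap
        (Proj.map (ProjBaseChangeRing.mapGraded A B (Fin (n + 1))) (ProjBaseChangeRing.irrelevant_le_map A B (Fin (n + 1))))).comap
        (Proj.map φ hφ')).support : Set (Proj (homogeneousSubmodule (Fin (n + 1)) k)))) =
      {x | ∀ g ∈ I.toIdeal, (φ (ProjBaseChangeRing.mapGraded A B (Fin (n + 1)) g) : MvPolynomial (Fin (n + 1)) k) ∈ x.asHomogeneousIdeal} := by
  letI := MvPolynomial.gradedAlgebra (σ := Fin (n + 1)) (R := A)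
  letI := MvPolynomial.gradedAlgebra (σ := Fin (n + 1)) (R := B)
  letI := MvPolynomial.gradedAlgebra (σ := Fin (n + 1)) (R := k)
  rw [support_comap, support_comap, Closeds.coe_preimage, Closeds.coe_preimage, CILift.support_projIdealSheaf_eq]
  ext x
  simp only [Set.mem_preimage, Set.mem_setOf_eq]
  constructor
  · intro h g hg
    exact h hg
  · intro h g hg
    exact h g hg

/-- **The hypersurface case**: `I = (F)` with `F` homogeneous, and a ring map `θ'` with `φ (F ⊗ 1) = MvPolynomial.map θ' F` (e.g. `θ' = θ ∘ (A → B)` for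
`φ = map θ`): the support is `{x | map θ' F ∈ x}` — the zero locus `V₊(F_θ')` of the specialised equation, i.e. the honest `Cut` «`range ι = V₊(F)`» ties.
[cite: Hartshorne1977, II Prop. 5.9] [OURS · L1 W4.5b · RUNG LC (B5′)(c3)] -/
theorem support_comap_comap_projIdealSheaf_span_singleton {d : ℕ} (F : MvPolynomial (Fin (n + 1)) A) (hF : F.IsHomogeneous d)
    (φ : letI := MvPolynomial.gradedAlgebra (σ := Fin (n + 1)) (R := B)
      letI := MvPolynomial.gradedAlgebra (σ := Fin (n + 1)) (R := k)
      homogeneousSubmodule (Fin (n + 1)) B →+*ᵍ homogeneousSubmodule (Fin (n + 1)) k)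
    (hφ' : letI := MvPolynomial.gradedAlgebra (σ := Fin (n + 1)) (R := B)
      letI := MvPolynomial.gradedAlgebra (σ := Fin (n + 1)) (R := k)
      HomogeneousIdeal.irrelevant (homogeneousSubmodule (Fin (n + 1)) k) ≤
        (HomogeneousIdeal.irrelevant (homogeneousSubmodule (Fin (n + 1)) B)).map φ)
    (θ' : A →+* k) (hφF : (φ (ProjBaseChangeRing.mapGraded A B (Fin (n + 1)) F) : MvPolynomial (Fin (n + 1)) k) = MvPolynomial.map θ' F) :
    letI := MvPolynomial.gradedAlgebra (σ := Fin (n + 1)) (R := A)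
    letI := MvPolynomial.gradedAlgebra (σ := Fin (n + 1)) (R := B)
    letI := MvPolynomial.gradedAlgebra (σ := Fin (n + 1)) (R := k)
    (((((projIdealSheaf (homogeneousSubmodule (Fin (n + 1)) A)
        ⟨Ideal.span {F}, Ideal.homogeneous_span _ _ (fun g hg => by
          rw [Set.mem_singleton_iff] at hg; subst hg; exact ⟨d, hF⟩)⟩).comap
        (Proj.map (ProjBaseChangeRing.mapGraded A B (Fin (n + 1))) (ProjBaseChangeRing.irrelevant_le_map A B (Fin (n + 1))))).comap
        (Proj.map φ hφ')).support : Set (Proj (homogeneousSubmodule (Fin (n + 1)) k)))) =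
      {x | MvPolynomial.map θ' F ∈ x.asHomogeneousIdeal} := by
  letI := MvPolynomial.gradedAlgebra (σ := Fin (n + 1)) (R := A)
  letI := MvPolynomial.gradedAlgebra (σ := Fin (n + 1)) (R := B)
  letI := MvPolynomial.gradedAlgebra (σ := Fin (n + 1)) (R := k)
  rw [support_comap_comap_projIdealSheaf]
  ext x
  simp only [Set.mem_setOf_eq]
  constructor
  · intro h
    rw [← hφF]
    exact h F (Ideal.subset_span rfl)
  · intro h g hg
    change g ∈ Ideal.span {F} at hg
    obtain ⟨c, rfl⟩ := Ideal.mem_span_singleton'.mp hg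
    rw [map_mul, map_mul]
    refine Ideal.mul_mem_left _ _ ?_
    show (φ (ProjBaseChangeRing.mapGraded A B (Fin (n + 1)) F) : MvPolynomial (Fin (n + 1)) k) ∈ x.asHomogeneousIdeal
    rw [hφF]; exact h

end Tie

end Summit.ResolutionOfSingularities.ResolutionOfSingularities.Cruxes.EquisingularLiftNat.Sections

end
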